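import Literature.Analysis.OperatorTheory.CayleyUnitary
import Mathlib.Analysis.Calculus.FDeriv.Mul
import HarnessLib

/-!
# Derivative bounds for the Cayley transform and its inverse

Analysis support file (everything proved; no definitions, no named facts), companion of
`CayleyUnitary` for the gauge-gluing step of A. Waldron, Invent. math. 217 (2019), Lemma 3.5 /
§4: explicit operator-norm bounds on the Fréchet derivatives of `cayleyU` near `0` and of
`cayleyUInv` near `1` (product rule and `hasFDerivAt_ringInverse`), which give the smallness
`|dk| ≲ |dχ||S| + |dS|` of the interpolating gauge transformation.

* `hasFDerivAt_cayleyU`, `norm_fderiv_cayleyU_le` — for `‖T‖ ≤ 1/2`: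
  `‖D cayleyU(T)‖ ≤ (‖1‖ + 1) + (‖1‖ + 1/2)(‖1‖ + 1)²`;
* `hasFDerivAt_cayleyUInv`, `norm_fderiv_cayleyUInv_le` — for `‖W − 1‖ ≤ 1`:
  `‖D cayleyUInv(W)‖ ≤ ½(‖1‖ + 1) + ¼(‖1‖ + 1)²`.

References: A. Waldron, Invent. math. 217 (2019), §3–§4 [Waldron2019]; [folklore].
-/

noncomputable section

open Set Metric Filter
open scoped Topology

namespace Literature.Analysis.OperatorTheory

variable {R : Type*} [NormedRing R] [NormedAlgebra ℝ R] [CompleteSpace R]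

/-- Derivative of `S ↦ (1 − S)⁻¹` at `T` with `1 − T = u` a unit: `H ↦ u⁻¹ H u⁻¹`. [folklore] -/
theorem hasFDerivAt_ringInverse_one_sub {T : R} (u : Rˣ) (hu : (u : R) = 1 - T) :
    HasFDerivAt (fun S : R => Ring.inverse (1 - S))
      (ContinuousLinearMap.mulLeftRight ℝ R (((u⁻¹ : Rˣ) : R)) (((u⁻¹ : Rˣ) : R))) T := by
  have h1 : HasFDerivAt (𝕜 := ℝ) Ring.inverse
      (-ContinuousLinearMap.mulLeftRight ℝ R (((u⁻¹ : Rˣ) : R)) (((u⁻¹ : Rˣ) : R))) (1 - T) := by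
    rw [← hu]; exact hasFDerivAt_ringInverse u
  have h2 : HasFDerivAt (fun S : R => 1 - S) (-(ContinuousLinearMap.id ℝ R)) T := by
    simpa using (hasFDerivAt_id T).const_sub (1 : R)
  have h := h1.comp T h2
  refine h.congr_fderiv ?_
  ext H
  simp

/-- **Derivative of the Cayley transform**: at `T` with `‖T‖ < 1`,
`D cayleyU(T) H = H (1−T)⁻¹ + (1 + T)(1−T)⁻¹ H (1−T)⁻¹`. [folklore] -/
theorem hasFDerivAt_cayleyU {T : R} (hT : ‖T‖ < 1) :
    HasFDerivAt (cayleyU (R := R))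
      ((1 + T) • ContinuousLinearMap.mulLeftRight ℝ R (Ring.inverse (1 - T)) (Ring.inverse (1 - T)) +
        MulOpposite.op (Ring.inverse (1 - T)) • (ContinuousLinearMap.id ℝ R)) T := by
  obtain ⟨u, hu⟩ := isUnit_one_sub_of_norm_lt hT
  have hinv : Ring.inverse (1 - T) = (((u⁻¹ : Rˣ) : R)) := by rw [← hu, Ring.inverse_unit]
  have ha : HasFDerivAt (fun S : R => 1 + S) (ContinuousLinearMap.id ℝ R) T := by
    simpa using (hasFDerivAt_id T).const_add (1 : R)
  have hb := hasFDerivAt_ringInverse_one_sub u hu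
  have h := ha.mul' hb
  rw [hinv]
  have heq : cayleyU (R := R) = (fun S : R => 1 + S) * fun S => Ring.inverse (1 - S) := by
    funext S; rfl
  rw [heq]
  have hpt : Ring.inverse (1 - T) = (((u⁻¹ : Rˣ) : R)) := hinv
  simpa only [hpt] using h

/-- **Operator-norm bound for `D cayleyU`** on `‖T‖ ≤ 1/2`. [folklore] -/
theorem norm_fderiv_cayleyU_le {T : R} (hT : ‖T‖ ≤ 1 / 2) :
    ‖fderiv ℝ (cayleyU (R := R)) T‖ ≤
      (‖(1 : R)‖ + 1) + (‖(1 : R)‖ + 1 / 2) * (‖(1 : R)‖ + 1) ^ 2 := by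
  have hT1 : ‖T‖ < 1 := by linarith
  rw [(hasFDerivAt_cayleyU hT1).fderiv]
  set K := Ring.inverse (1 - T) with hK
  have hKn : ‖K‖ ≤ ‖(1 : R)‖ + 1 := norm_ringInverse_one_sub_le_of_le_half hT
  have h1T : ‖1 + T‖ ≤ ‖(1 : R)‖ + 1 / 2 := (norm_add_le _ _).trans (by linarith)
  refine ContinuousLinearMap.opNorm_le_bound _ (by positivity) fun H => ?_
  simp only [add_apply, smul_apply,
    ContinuousLinearMap.mulLeftRight_apply, ContinuousLinearMap.id_apply, smul_eq_mul,
    MulOpposite.smul_eq_mul_unop, MulOpposite.unop_op]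
  calc ‖(1 + T) * (K * H * K) + H * K‖ ≤ ‖(1 + T) * (K * H * K)‖ + ‖H * K‖ := norm_add_le _ _
    _ ≤ ‖1 + T‖ * (‖K‖ * ‖H‖ * ‖K‖) + ‖H‖ * ‖K‖ := by
        refine add_le_add ((norm_mul_le _ _).trans (mul_le_mul_of_nonneg_left ?_ (norm_nonneg _)))
          (norm_mul_le _ _)
        exact (norm_mul_le _ _).trans (mul_le_mul_of_nonneg_right (norm_mul_le _ _) (norm_nonneg _))
    _ ≤ (‖(1 : R)‖ + 1 / 2) * ((‖(1 : R)‖ + 1) * ‖H‖ * (‖(1 : R)‖ + 1)) + ‖H‖ * (‖(1 : R)‖ + 1) := by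
        have hH := norm_nonneg H
        have hK0 := norm_nonneg K
        refine add_le_add (mul_le_mul h1T ?_ (by positivity) (by positivity))
          (mul_le_mul_of_nonneg_left hKn hH)
        exact mul_le_mul (mul_le_mul_of_nonneg_right hKn hH) hKn hK0 (by positivity)
    _ = ((‖(1 : R)‖ + 1) + (‖(1 : R)‖ + 1 / 2) * (‖(1 : R)‖ + 1) ^ 2) * ‖H‖ := by ring

/-- Derivative of `V ↦ (V + 1)⁻¹` at `W` with `W + 1 = u` a unit: `H ↦ −u⁻¹ H u⁻¹`. [folklore] -/
theorem hasFDerivAt_ringInverse_add_one {W : R} (u : Rˣ) (hu : (u : R) = W + 1) :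
    HasFDerivAt (fun V : R => Ring.inverse (V + 1))
      (-ContinuousLinearMap.mulLeftRight ℝ R (((u⁻¹ : Rˣ) : R)) (((u⁻¹ : Rˣ) : R))) W := by
  have h1 : HasFDerivAt (𝕜 := ℝ) Ring.inverse
      (-ContinuousLinearMap.mulLeftRight ℝ R (((u⁻¹ : Rˣ) : R)) (((u⁻¹ : Rˣ) : R))) (W + 1) := by
    rw [← hu]; exact hasFDerivAt_ringInverse u
  have h2 : HasFDerivAt (fun V : R => V + 1) (ContinuousLinearMap.id ℝ R) W := by
    simpa using (hasFDerivAt_id W).add_const (1 : R)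
  have h := h1.comp W h2
  refine h.congr_fderiv ?_
  ext H
  simp

/-- **Derivative of the inverse Cayley transform** at `W` with `‖W − 1‖ < 2`. [folklore] -/
theorem hasFDerivAt_cayleyUInv {W : R} (hW : ‖W - 1‖ < 2) :
    HasFDerivAt (cayleyUInv (R := R))
      ((W - 1) • (-ContinuousLinearMap.mulLeftRight ℝ R (Ring.inverse (W + 1)) (Ring.inverse (W + 1))) +
        MulOpposite.op (Ring.inverse (W + 1)) • (ContinuousLinearMap.id ℝ R)) W := by
  obtain ⟨u, hu⟩ := isUnit_add_one hW
  have hinv : Ring.inverse (W + 1) = (((u⁻¹ : Rˣ) : R)) := by rw [← hu, Ring.inverse_unit]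
  have ha : HasFDerivAt (fun V : R => V - 1) (ContinuousLinearMap.id ℝ R) W := by
    simpa using (hasFDerivAt_id W).sub_const (1 : R)
  have hb := hasFDerivAt_ringInverse_add_one u hu
  have h := ha.mul' hb
  rw [hinv]
  have heq : cayleyUInv (R := R) = (fun V : R => V - 1) * fun V => Ring.inverse (V + 1) := by
    funext V; rfl
  rw [heq]
  have hpt : Ring.inverse (W + 1) = (((u⁻¹ : Rˣ) : R)) := hinv
  simpa only [hpt] using h

/-- **Operator-norm bound for `D cayleyUInv`** on `‖W − 1‖ ≤ 1`. [folklore] -/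
theorem norm_fderiv_cayleyUInv_le {W : R} (hW : ‖W - 1‖ ≤ 1) :
    ‖fderiv ℝ (cayleyUInv (R := R)) W‖ ≤
      (1 / 2) * (‖(1 : R)‖ + 1) + ((1 / 2) * (‖(1 : R)‖ + 1)) ^ 2 := by
  have hW2 : ‖W - 1‖ < 2 := by linarith
  rw [(hasFDerivAt_cayleyUInv hW2).fderiv]
  set K := Ring.inverse (W + 1) with hK
  have hKn : ‖K‖ ≤ (1 / 2) * (‖(1 : R)‖ + 1) := norm_ringInverse_add_one_le hW
  refine ContinuousLinearMap.opNorm_le_bound _ (by positivity) fun H => ?_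
  simp only [add_apply, smul_apply, neg_apply,
    ContinuousLinearMap.mulLeftRight_apply, ContinuousLinearMap.id_apply, smul_eq_mul,
    MulOpposite.smul_eq_mul_unop, MulOpposite.unop_op, mul_neg]
  calc ‖-((W - 1) * (K * H * K)) + H * K‖ ≤ ‖(W - 1) * (K * H * K)‖ + ‖H * K‖ := by
        refine (norm_add_le _ _).trans ?_; rw [norm_neg]
    _ ≤ ‖W - 1‖ * (‖K‖ * ‖H‖ * ‖K‖) + ‖H‖ * ‖K‖ := by
        refine add_le_add ((norm_mul_le _ _).trans (mul_le_mul_of_nonneg_left ?_ (norm_nonneg _)))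
          (norm_mul_le _ _)
        exact (norm_mul_le _ _).trans (mul_le_mul_of_nonneg_right (norm_mul_le _ _) (norm_nonneg _))
    _ ≤ 1 * ((1 / 2) * (‖(1 : R)‖ + 1) * ‖H‖ * ((1 / 2) * (‖(1 : R)‖ + 1))) +
          ‖H‖ * ((1 / 2) * (‖(1 : R)‖ + 1)) := by
        have hH := norm_nonneg H
        have hK0 := norm_nonneg K
        refine add_le_add (mul_le_mul hW ?_ (by positivity) (by positivity))
          (mul_le_mul_of_nonneg_left hKn hH)
        exact mul_le_mul (mul_le_mul_of_nonneg_right hKn hH) hKn hK0 (by positivity)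
    _ = ((1 / 2) * (‖(1 : R)‖ + 1) + ((1 / 2) * (‖(1 : R)‖ + 1)) ^ 2) * ‖H‖ := by ring

end Literature.Analysis.OperatorTheory
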